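import Summits.BirchSwinnertonDyer.BirchSwinnertonDyer.Theorems.GenusKolyvaginAtTwoEquivariantChebotarevAtTwoQ5Shape
import Summits.BirchSwinnertonDyer.BirchSwinnertonDyer.Theorems.CMKolyvaginAtInertTwoRestrictionInjectiveAtTwo
import Literature.NumberTheory.EllipticCurves.HeegnerPointsKolyvaginPairing
import Literature.NumberTheory.EllipticCurves.HeegnerPointsKolyvaginLocalCriterion

/-!
# Route `GenusKolyvaginAtTwo`, LINE 6, Q5 `EquivariantChebotarevAtTwo`: the `𝔽₄`-STRUCTURE of
# `H¹(K, E[2])` at the discriminant field `K = ℚ(√Δ_E)`, constructed in the kernel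
# (helper, PROVED; seat gk2-p2 g6; route-independent — no `Theses` import)

Why Q5 (item stmt-BirchSwinnertonDyer-24881) needs the parent's binder `K ≠ ℚ(√Δ_E)`: at the
discriminant field `ρ̄_{E,2}(Γ_K) = A₃ = ⟨z⟩`, so `z` acts on the coefficients `E[2]` as a
`Γ_K`-equivariant automorphism with `z² + z + 1 = 0`, and `H¹(K, E[2])` becomes an `𝔽₄ = 𝔽₂[z]`-space
on which complex conjugation acts SEMILINEARLY and every local kernel is a subspace — the structure
`DiscFieldFourStructureAtTwo` modulo which `¬Q5` is booked (`Theorems/EquivariantChebotarevAtTwo/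
Negative/…FalseOfDiscFieldFourStructureAtTwo`, p607006). This file builds that structure from the
Galois picture; the sequel `…/Negative/…FalseOfDiscFieldClassAtTwo` consumes it.

* §1 (any field `K`, any curve `X/K`, any level `n`): `coeffH1Map X n ψ` = `H¹(id, ψ)` for a
  `Γ_K`-equivariant additive endomorphism `ψ` of `E(K̄)[n]` (Mathlib `ContinuousCohomology.map` along
  the compatible pair `(id, ψ)`); `h1Eval_coeffH1Map`: `[ψ_* x, ρ] = ψ [x, ρ]` for `ρ ∈ Γ_{K(E[n])}`;
  `coeffH1Map_mem_torsionLocalKer`: `ψ_*` preserves every strict local kernel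
  `ker (H¹(K, E[n]) → H¹(K_v, E(K̄_v)[n]))` (the local coboundary `gQ − Q`, `Q = ι P`, is sent to the
  coboundary of `ι(ψ P)`; uses `E(K̄)[n] → E(K̄_v)[n]` injective and onto).
* §2 (the `4`-group `E(K̄)[2]`, `W/ℚ`, `K` a number field): if no element of `Γ_K` acts as a
  transposition, an order-`3`-type `z` (no non-zero fixed point) commutes with `Γ_K`
  (`smul_comm_of_noTransposition`); a transposition `T` (involutive, a non-zero fixed point, a moved
  point) and such a `z` satisfy `T z = z² T` (`transposition_conj_three` — `S₃` is dihedral).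
* §3 `exists_fourStructure_of_noTransposition`: for `W/ℚ` with `Δ < 0` and `ρ̄_{W,2}` onto, `K`
  imaginary quadratic with `c ≠ 1` and NO transposition in `ρ̄_{W,2}(Γ_K)`, and a class
  `x ∈ H¹(K, E[2])` generic with respect to `x^c` on `Γ_{K(E[2])}`: there is an additive `ω` on
  `H¹(K, E[2])` with `ω² + ω + 1 = 0`, `c_* ∘ ω = ω² ∘ c_*`, `ω`-stable strict local kernels, and
  `x, ωx, x^c, ωx^c` `𝔽₂`-independent — literally the fields of `DiscFieldFourStructureData`.
  (`ω := H¹(id, z)`, `z` from `KolyvaginImageTwo.exists_smul_three_of_hasSurjectiveModNGaloisRep`;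
  the two identities are checked on `Γ_{K(E[2])}` — `[c_* y, ρ] = τ̃[y, τ̃⁻¹ρτ̃]`
  (`IsLiftOfAut.h1Eval_conjAct`), `τ̃` the involutive lift transported from a complex conjugation,
  a transposition on `E[2]` because `Δ < 0` (`KolyvaginEigenTwo.exists_twoTorsion_smul_ne_of_Δ_neg`)
  — and lifted by `KolyvaginImageTwo.h1_restriction_injective_two`.)

HONEST FRAMING. Helper theorems (`--supports 24881`); nothing is closed; the one new `def` is the
functoriality map `coeffH1Map` (data, no `Prop`). BSD is not proved by any of this.

References: [GrossLMS1991] §9 (pairing `[s, ρ]`, Prop. 9.1; standing hypothesis `K ⊄ ℚ(E_p)`);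
[McCallumLMS1991] §3 (2)–(3); [LawsonWuthrich2016] Lemma 6; [SerreGaloisCohomology1997] I.§2.4
(functoriality of `H¹` along compatible pairs); [SilvermanAEC2009] III.6.4.
-/

set_option autoImplicit false
set_option linter.dupNamespace false

noncomputable section

open scoped Classical

namespace Summit.BirchSwinnertonDyer.BirchSwinnertonDyer.Theorems.GenusExact

open WeierstrassCurve NumberField IsDedekindDomain Field Finset
open Literature.NumberTheory.GaloisRepresentations Literature.NumberTheory.EllipticCurves
open Literature.NumberTheory

universe u

/-! ### §1 Functoriality of `H¹(K, E[n])` in the coefficients -/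

section Coeff

variable {K : Type u} [Field K] (X : WeierstrassCurve K) (n : ℤ)

/-- **`H¹(id, ψ)`**: the endomorphism of `H¹(K, E[n])` induced by a `Γ_K`-equivariant additive
endomorphism `ψ` of the coefficient module `E(K̄)[n]` (Mathlib `ContinuousCohomology.map` along the
compatible pair `(id, ψ)`; on cocycles `[f] ↦ [ψ ∘ f]`). [folklore] -/
def coeffH1Map (ψ : geomTorsion X n →+ geomTorsion X n)
    (hψ : ∀ (g : absoluteGaloisGroup K) (t : geomTorsion X n), ψ (g • t) = g • ψ t) :
    galH1Torsion X n →+ galH1Torsion X n :=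
  (ContinuousCohomology.map (ContinuousMonoidHom.id (absoluteGaloisGroup K))
    (resHomOfEquivariant (ContinuousMonoidHom.id (absoluteGaloisGroup K)) ψ
      (fun g t ↦ hψ g t)) 1).hom.toLinearMap.toAddMonoidHom

variable {X n}

/-- **Evaluation of `H¹(id, ψ) x`:** `[ψ_* x, ρ] = ψ [x, ρ]` for `ρ ∈ Γ_{K(E[n])}` (the cocycle of
`ψ_* x` is `ψ ∘ f`). [folklore] -/
theorem h1Eval_coeffH1Map (ψ : geomTorsion X n →+ geomTorsion X n)
    (hψ : ∀ (g : absoluteGaloisGroup K) (t : geomTorsion X n), ψ (g • t) = g • ψ t)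
    (x : galH1Torsion X n) {ρ : absoluteGaloisGroup K} (hρ : ρ ∈ torsionFixing X n) :
    h1Eval X n (coeffH1Map X n ψ hψ x) ρ = ψ (h1Eval X n x ρ) := by
  conv_lhs => rw [← oneCocycleClass_reprCocycle X n x]
  unfold coeffH1Map
  rw [LinearMap.toAddMonoidHom_coe, ContinuousLinearMap.coe_coe, map_oneCocycleClass,
    h1Eval_oneCocycleClass _ n _ hρ, contOneCocycles.pullback_apply]
  rfl

/-- **`H¹(id, ψ)` preserves every strict local kernel** `ker (H¹(K, E[n]) → H¹(K_v, E(K̄_v)[n]))`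
when `E(K̄)[n] → E(K̄_v)[n]` is onto (always, for `n ≠ 0`): a local coboundary `g ↦ gQ − Q`,
`Q = ι(P)`, is mapped to the coboundary of `ι(ψ P)`. [folklore] -/
theorem coeffH1Map_mem_torsionLocalKer (ψ : geomTorsion X n →+ geomTorsion X n)
    (hψ : ∀ (g : absoluteGaloisGroup K) (t : geomTorsion X n), ψ (g • t) = g • ψ t)
    (E : Type u) [Field E] [Algebra K E]
    (hsurj : Function.Surjective (torsionPointsMap X E n))
    {x : galH1Torsion X n} (hx : x ∈ X.torsionLocalKer E n) :
    coeffH1Map X n ψ hψ x ∈ X.torsionLocalKer E n := by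
  -- a cocycle `f` of `x`; `ψ_* x` is the class of `ψ ∘ f`
  obtain ⟨f, rfl⟩ :=
    oneCocycleClass_surjective (discreteTopRep (absoluteGaloisGroup K) (geomTorsion X n)) x
  have hinner : coeffH1Map X n ψ hψ (oneCocycleClass _ f) =
      oneCocycleClass _ (contOneCocycles.pullback (ContinuousMonoidHom.id (absoluteGaloisGroup K))
        (resHomOfEquivariant (ContinuousMonoidHom.id (absoluteGaloisGroup K)) ψ
          (fun g t ↦ hψ g t)) f) := by
    unfold coeffH1Map
    rw [LinearMap.toAddMonoidHom_coe, ContinuousLinearMap.coe_coe, map_oneCocycleClass]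
  rw [hinner]
  -- both local classes are classes of pulled-back cocycles
  change _ = 0 at hx
  change _ = 0
  rw [LinearMap.toAddMonoidHom_coe, ContinuousLinearMap.coe_coe, map_oneCocycleClass,
    oneCocycleClass_eq_zero_iff] at hx ⊢
  obtain ⟨Q, hQ⟩ := hx
  obtain ⟨P, rfl⟩ := hsurj Q
  refine ⟨torsionPointsMap X E n (ψ P), fun g ↦ ?_⟩
  have hg := hQ g
  rw [contOneCocycles.pullback_apply, discreteTopRep_ρ_apply] at hg ⊢
  -- `hg : ι (f (res g)) = g • ι P - ι P`, so `f (res g) = res g • P - P`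
  have hg' : torsionPointsMap X E n (f.1 (resGal (K := K) E g)) =
      torsionPointsMap X E n (resGal (K := K) E g • P - P) := by
    rw [map_sub, torsionPointsMap_smul]; exact hg
  have hinj := torsionPointsMap_injective X E n hg'
  change torsionPointsMap X E n (ψ (f.1 (resGal (K := K) E g))) = _
  rw [hinj, map_sub, hψ, map_sub, torsionPointsMap_smul]

end Coeff

/-! ### §2 The `4`-group `E[2]`: an order-`3` element commuting with a transposition-free image -/

section Four

variable {K : Type} [Field K] [NumberField K] (W : WeierstrassCurve ℚ) [W.IsElliptic]

omit [W.IsElliptic] in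
/-- `t + t = 0` on `E(K̄)[2]` (level `2 = 2^1`). [folklore] -/
theorem add_self_geomTorsion_twoPowOne (t : geomTorsion (W.baseChange K) ((2 ^ 1 : ℕ) : ℤ)) :
    t + t = 0 := by
  have h := AddSubgroup.torsionBy.nsmul t
  rw [← two_nsmul]
  exact h

/-- `#E(K̄)[2] = 4` (level `2 = 2^1`). [cite: SilvermanAEC2009, Cor. III.6.4(b)] -/
theorem natCard_geomTorsion_twoPowOne :
    Nat.card (geomTorsion (W.baseChange K) ((2 ^ 1 : ℕ) : ℤ)) = 4 :=
  KolyvaginImageTwo.natCard_geomTorsion_two W K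

/-- **If no element of `Γ_K` acts on `E[2]` as a transposition, an order-`3`-type element `z`
(no non-zero fixed point) commutes with all of `Γ_K` on `E[2]`**: every `g` acts trivially or
without fixed points, and a fixed-point-free automorphism of the `4`-group is `z` or `z²`.
[cite: LawsonWuthrich2016, Lemma 6] -/
theorem smul_comm_of_noTransposition
    (hA3 : ∀ (g : absoluteGaloisGroup K) (u : geomTorsion (W.baseChange K) ((2 ^ 1 : ℕ) : ℤ)),
      u ≠ 0 → g • u = u → ∀ w : geomTorsion (W.baseChange K) ((2 ^ 1 : ℕ) : ℤ), g • w = w)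
    {z : absoluteGaloisGroup K}
    (hzfix : ∀ P : geomTorsion (W.baseChange K) ((2 ^ 1 : ℕ) : ℤ), z • P = P → P = 0)
    (g : absoluteGaloisGroup K) (t : geomTorsion (W.baseChange K) ((2 ^ 1 : ℕ) : ℤ)) :
    z • g • t = g • z • t := by
  by_cases hg : ∃ u : geomTorsion (W.baseChange K) ((2 ^ 1 : ℕ) : ℤ), u ≠ 0 ∧ g • u = u
  · obtain ⟨u, hu0, hu⟩ := hg
    rw [hA3 g u hu0 hu t, hA3 g u hu0 hu (z • t)]
  · push Not at hg
    have hgfix : ∀ P : geomTorsion (W.baseChange K) ((2 ^ 1 : ℕ) : ℤ), g • P = P → P = 0 :=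
      fun P hP ↦ by_contra fun h ↦ hg P h hP
    let gA : geomTorsion (W.baseChange K) ((2 ^ 1 : ℕ) : ℤ) ≃+
        geomTorsion (W.baseChange K) ((2 ^ 1 : ℕ) : ℤ) := DistribMulAction.toAddEquiv _ g
    let zA : geomTorsion (W.baseChange K) ((2 ^ 1 : ℕ) : ℤ) ≃+
        geomTorsion (W.baseChange K) ((2 ^ 1 : ℕ) : ℤ) := DistribMulAction.toAddEquiv _ z
    rcases KolyvaginImageTwo.eq_or_eq_sq_of_fixedPointFree (add_self_geomTorsion_twoPowOne W)
      (natCard_geomTorsion_twoPowOne W) gA zA hgfix hzfix with h | h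
    · have h' : ∀ s : geomTorsion (W.baseChange K) ((2 ^ 1 : ℕ) : ℤ), g • s = z • s :=
        fun s ↦ h s
      rw [h', h']
    · have h' : ∀ s : geomTorsion (W.baseChange K) ((2 ^ 1 : ℕ) : ℤ), g • s = z • z • s :=
        fun s ↦ h s
      rw [h', h']

/-- **A transposition `T` and an order-`3`-type `z` on the `4`-group satisfy `T z T = z²`**
(`S₃` is dihedral): for an involutive additive `T` with a non-zero fixed point `u` and a moved
point `w`, and `z` without non-zero fixed points, `T (z e) = z (z (T e))`. [folklore] -/
theorem transposition_conj_three {T' : geomTorsion (W.baseChange K) ((2 ^ 1 : ℕ) : ℤ) →+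
      geomTorsion (W.baseChange K) ((2 ^ 1 : ℕ) : ℤ)}
    (hTT : ∀ e, T' (T' e) = e) {u w : geomTorsion (W.baseChange K) ((2 ^ 1 : ℕ) : ℤ)}
    (hu0 : u ≠ 0) (hu : T' u = u) (hw : T' w ≠ w) {z : absoluteGaloisGroup K}
    (hzfix : ∀ P : geomTorsion (W.baseChange K) ((2 ^ 1 : ℕ) : ℤ), z • P = P → P = 0)
    (e : geomTorsion (W.baseChange K) ((2 ^ 1 : ℕ) : ℤ)) : T' (z • e) = z • z • T' e := by
  have h2 := add_self_geomTorsion_twoPowOne (K := K) W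
  have hcard := natCard_geomTorsion_twoPowOne (K := K) W
  let TA : geomTorsion (W.baseChange K) ((2 ^ 1 : ℕ) : ℤ) ≃+
      geomTorsion (W.baseChange K) ((2 ^ 1 : ℕ) : ℤ) :=
    { T' with invFun := T', left_inv := hTT, right_inv := hTT }
  have hTA : ∀ t, TA t = T' t := fun _ ↦ rfl
  let zA : geomTorsion (W.baseChange K) ((2 ^ 1 : ℕ) : ℤ) ≃+
      geomTorsion (W.baseChange K) ((2 ^ 1 : ℕ) : ℤ) := DistribMulAction.toAddEquiv _ z
  have hzA : ∀ t, zA t = z • t := fun _ ↦ rfl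
  -- `σ = T z T` has no non-zero fixed point
  let σ := TA.trans (zA.trans TA)
  have hσ : ∀ t, σ t = T' (z • T' t) := fun _ ↦ rfl
  have hσfix : ∀ t, σ t = t → t = 0 := fun t ht ↦ by
    rw [hσ] at ht
    have h1 : z • T' t = T' t := by
      have := congrArg T' ht
      rwa [hTT] at this
    have h0 : T' t = 0 := hzfix _ h1
    have := congrArg T' h0
    rwa [hTT, map_zero] at this
  rcases KolyvaginImageTwo.eq_or_eq_sq_of_fixedPointFree h2 hcard σ zA hσfix hzfix with h | h
  · -- `T z T = z`: then `T` fixes `u` and `z u`, hence everything — contradiction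
    exfalso
    have hzu : T' (z • u) = z • u := by
      have := h u
      rwa [hσ, hzA, hu] at this
    obtain ⟨hzu0, hzuu, -⟩ :=
      KolyvaginImageTwo.apply_apply_eq_add_of_fixedPointFree h2 hcard zA hzfix hu0
    rw [hzA] at hzu0 hzuu
    apply hw
    rcases KolyvaginImageTwo.mem_four h2 hcard hu0 hzu0 hzuu w with rfl | rfl | rfl | rfl
    · exact map_zero T'
    · exact hu
    · exact hzu
    · rw [map_add, hu, hzu]
  · have := h (T' e)
    rwa [hσ, hTT, hzA, hzA] at this

end Four

/-! ### §3 The `𝔽₄`-structure from ONE generic class -/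

section Main

set_option maxHeartbeats 1600000 in
/-- **The `𝔽₄`-structure of `H¹(K, E[2])` CONSTRUCTED from a generic class at the discriminant
field** (the fields of `DiscFieldFourStructureData`, as an existential). With `z ∈ Γ_K` of order-`3` type
(`KolyvaginImageTwo.exists_smul_three_of_hasSurjectiveModNGaloisRep`), commuting with `Γ_K` on
`E[2]` (no transposition), `ω := H¹(id, z)` (`coeffH1Map`) satisfies: `ω² + ω + 1 = 0` and
`c_* ∘ ω = ω² ∘ c_*` (both checked on `Γ_{K(E[2])}` through `[ω y, ρ] = z[y, ρ]`,
`[c_* y, ρ] = τ̃[y, τ̃⁻¹ρτ̃]`, `τ̃ z τ̃ = z²` on the `4`-group, and the injectivity of restriction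
`KolyvaginImageTwo.h1_restriction_injective_two`), `ω` preserves every strict local kernel
(`coeffH1Map_mem_torsionLocalKer`), and `x, ωx, x^c, ωx^c` are `𝔽₂`-independent (evaluate at
`ρ₁`, `ρ₂`). [cite: GrossLMS1991, §9 (pairing [s, ρ], Prop. 9.1)] [cite: LawsonWuthrich2016, Lemma 6] -/
theorem exists_fourStructure_of_noTransposition {K : Type} [Field K] [NumberField K]
    (W : WeierstrassCurve ℚ) [W.IsElliptic] (hΔ : W.Δ < 0) (hK : IsImaginaryQuadratic K)
    (hρ : ∀ n : ℕ, W.HasSurjectiveModNGaloisRep (2 ^ n : ℕ)) {c : K ≃ₐ[ℚ] K} (hc : c ≠ 1)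
    (hA3 : ∀ (g : absoluteGaloisGroup K) (u : geomTorsion (W.baseChange K) ((2 ^ 1 : ℕ) : ℤ)),
      u ≠ 0 → g • u = u → ∀ w : geomTorsion (W.baseChange K) ((2 ^ 1 : ℕ) : ℤ), g • w = w)
    {x : galH1Torsion (W.baseChange K) ((2 ^ 1 : ℕ) : ℤ)}
    (hgen : ∃ ρ₁ ∈ torsionFixing (W.baseChange K) ((2 ^ 1 : ℕ) : ℤ),
      ∃ ρ₂ ∈ torsionFixing (W.baseChange K) ((2 ^ 1 : ℕ) : ℤ),
        h1Eval (W.baseChange K) ((2 ^ 1 : ℕ) : ℤ) x ρ₁ ≠ 0 ∧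
        h1Eval (W.baseChange K) ((2 ^ 1 : ℕ) : ℤ) (conjAct W c ((2 ^ 1 : ℕ) : ℤ) x) ρ₁ = 0 ∧
        h1Eval (W.baseChange K) ((2 ^ 1 : ℕ) : ℤ) x ρ₂ = 0 ∧
        h1Eval (W.baseChange K) ((2 ^ 1 : ℕ) : ℤ) (conjAct W c ((2 ^ 1 : ℕ) : ℤ) x) ρ₂ ≠ 0) :
    ∃ ω : galH1Torsion (W.baseChange K) ((2 ^ 1 : ℕ) : ℤ) →+
        galH1Torsion (W.baseChange K) ((2 ^ 1 : ℕ) : ℤ),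
      (∀ y, ω (ω y) + ω y + y = 0) ∧
      (∀ y, conjAct W c ((2 ^ 1 : ℕ) : ℤ) (ω y) = ω (ω (conjAct W c ((2 ^ 1 : ℕ) : ℤ) y))) ∧
      (∀ (v : HeightOneSpectrum (𝓞 K)) (y : galH1Torsion (W.baseChange K) ((2 ^ 1 : ℕ) : ℤ)),
        y ∈ (W.baseChange K).torsionLocalKer (v.adicCompletion K) ((2 ^ 1 : ℕ) : ℤ) →
          ω y ∈ (W.baseChange K).torsionLocalKer (v.adicCompletion K) ((2 ^ 1 : ℕ) : ℤ)) ∧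
      (∀ a b d e : ℤ, a • x + b • ω x + d • conjAct W c ((2 ^ 1 : ℕ) : ℤ) x +
          e • ω (conjAct W c ((2 ^ 1 : ℕ) : ℤ) x) = 0 →
        (2 : ℤ) ∣ a ∧ (2 : ℤ) ∣ b ∧ (2 : ℤ) ∣ d ∧ (2 : ℤ) ∣ e) := by
  haveI : (W.baseChange K).IsElliptic := by rw [baseChange]; infer_instance
  have hsurj : W.HasSurjectiveModNGaloisRep 2 := by simpa using hρ 1
  have h2 := add_self_geomTorsion_twoPowOne (K := K) W
  have hcard := natCard_geomTorsion_twoPowOne (K := K) W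
  have h2z : ∀ e : geomTorsion (W.baseChange K) ((2 ^ 1 : ℕ) : ℤ), (2 : ℤ) • e = 0 :=
    fun e ↦ by rw [two_zsmul]; exact h2 e
  -- ### the order-`3` element `z` and the coefficient endomorphism `ω = H¹(id, z)`
  obtain ⟨z, -, hzfix⟩ :=
    KolyvaginImageTwo.exists_smul_three_of_hasSurjectiveModNGaloisRep W K hK.1 hsurj
  have hzfix' : ∀ P : geomTorsion (W.baseChange K) ((2 ^ 1 : ℕ) : ℤ), z • P = P → P = 0 :=
    fun P hP ↦ hzfix P hP
  have hzne : ∀ e : geomTorsion (W.baseChange K) ((2 ^ 1 : ℕ) : ℤ), e ≠ 0 → z • e ≠ e :=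
    fun e he h ↦ he (hzfix' e h)
  let zA : geomTorsion (W.baseChange K) ((2 ^ 1 : ℕ) : ℤ) ≃+
      geomTorsion (W.baseChange K) ((2 ^ 1 : ℕ) : ℤ) := DistribMulAction.toAddEquiv _ z
  have hzA : ∀ t, zA t = z • t := fun _ ↦ rfl
  have hzz : ∀ e : geomTorsion (W.baseChange K) ((2 ^ 1 : ℕ) : ℤ),
      z • z • e + z • e + e = 0 := by
    intro e
    by_cases he : e = 0
    · rw [he, smul_zero, smul_zero, add_zero, add_zero]
    · obtain ⟨-, -, hze⟩ :=
        KolyvaginImageTwo.apply_apply_eq_add_of_fixedPointFree h2 hcard zA hzfix' he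
      rw [hzA, hzA] at hze
      have h3 : e + z • e + z • e + e = (z • e + z • e) + (e + e) := by abel
      rw [hze, h3, h2, h2, add_zero]
  let ψ : geomTorsion (W.baseChange K) ((2 ^ 1 : ℕ) : ℤ) →+
      geomTorsion (W.baseChange K) ((2 ^ 1 : ℕ) : ℤ) := DistribSMul.toAddMonoidHom _ z
  have hψapp : ∀ t, ψ t = z • t := fun _ ↦ rfl
  have hψ : ∀ (g : absoluteGaloisGroup K) (t : geomTorsion (W.baseChange K) ((2 ^ 1 : ℕ) : ℤ)),
      ψ (g • t) = g • ψ t := fun g t ↦ by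
    rw [hψapp, hψapp, smul_comm_of_noTransposition W hA3 hzfix' g t]
  let ω := coeffH1Map (W.baseChange K) ((2 ^ 1 : ℕ) : ℤ) ψ hψ
  have hωeval : ∀ (y : galH1Torsion (W.baseChange K) ((2 ^ 1 : ℕ) : ℤ)) {ρ : absoluteGaloisGroup K},
      ρ ∈ torsionFixing (W.baseChange K) ((2 ^ 1 : ℕ) : ℤ) →
        h1Eval (W.baseChange K) ((2 ^ 1 : ℕ) : ℤ) (ω y) ρ =
          z • h1Eval (W.baseChange K) ((2 ^ 1 : ℕ) : ℤ) y ρ :=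
    fun y ρ hρ ↦ h1Eval_coeffH1Map ψ hψ y hρ
  -- ### `ω² + ω + 1 = 0` (checked on `Γ_{K(E[2])}`)
  have hω1 : ∀ y, ω (ω y) + ω y + y = 0 := fun y ↦ by
    apply KolyvaginImageTwo.h1_restriction_injective_two W K hK.1 hsurj
    intro ρ hρ
    have hρ' : ρ ∈ torsionFixing (W.baseChange K) ((2 ^ 1 : ℕ) : ℤ) := hρ
    show h1Eval (W.baseChange K) ((2 ^ 1 : ℕ) : ℤ) (ω (ω y) + ω y + y) ρ = 0
    rw [h1Eval_add _ _ _ _ hρ', h1Eval_add _ _ _ _ hρ', hωeval (ω y) hρ', hωeval y hρ']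
    exact hzz _
  -- ### the involutive lift of `c` acts on `E[2]` as a transposition
  obtain ⟨c₀, hc₀⟩ := exists_isComplexConjugation (Rat.castHom ℝ)
  have ht : IsLiftOfAut c (absGaloisTransport (K := ℚ) (L := K) c₀).toRingEquiv :=
    RatClosure.isLiftOfAut_absGaloisTransport_of_isImaginaryQuadratic hK hc hc₀
  have hinv : ∀ y, (absGaloisTransport (K := ℚ) (L := K) c₀).toRingEquiv
      ((absGaloisTransport (K := ℚ) (L := K) c₀).toRingEquiv y) = y := fun y ↦
    RatClosure.absGaloisTransport_absGaloisTransport_of_sq_eq_one hc₀.sq_eq_one y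
  have hTT : ∀ e, ht.torsionMap W ((2 ^ 1 : ℕ) : ℤ) (ht.torsionMap W ((2 ^ 1 : ℕ) : ℤ) e) = e :=
    ht.torsionMap_torsionMap W hinv _
  obtain ⟨v, hv⟩ := KolyvaginEigenTwo.exists_twoTorsion_smul_ne_of_Δ_neg W hΔ hc₀
  let θ := RatClosure.torsionEquiv (K := K) W ((2 ^ 1 : ℕ) : ℤ)
  have hθ : ∀ P, ht.torsionMap W ((2 ^ 1 : ℕ) : ℤ) (θ P) = θ (c₀ • P) := fun P ↦
    (RatClosure.torsionEquiv_smul_of_lift W ht c₀ (fun _ ↦ rfl) _ P).symm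
  have hw : ht.torsionMap W ((2 ^ 1 : ℕ) : ℤ) (θ v) ≠ θ v := by
    rw [hθ]
    exact fun h ↦ hv (θ.injective h)
  have hu : ht.torsionMap W ((2 ^ 1 : ℕ) : ℤ) (θ v + ht.torsionMap W ((2 ^ 1 : ℕ) : ℤ) (θ v)) =
      θ v + ht.torsionMap W ((2 ^ 1 : ℕ) : ℤ) (θ v) := by
    rw [map_add, hTT, add_comm]
  have hu0 : θ v + ht.torsionMap W ((2 ^ 1 : ℕ) : ℤ) (θ v) ≠ 0 := by
    intro h0
    apply hw
    have h1 : ht.torsionMap W ((2 ^ 1 : ℕ) : ℤ) (θ v) = -θ v := eq_neg_of_add_eq_zero_right h0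
    rw [h1, neg_eq_iff_add_eq_zero, h2]
  have hkey : ∀ e, ht.torsionMap W ((2 ^ 1 : ℕ) : ℤ) (z • e) =
      z • z • ht.torsionMap W ((2 ^ 1 : ℕ) : ℤ) e :=
    transposition_conj_three W hTT hu0 hu hw hzfix'
  -- ### `c_* ∘ ω = ω² ∘ c_*` (checked on `Γ_{K(E[2])}`)
  have hω2 : ∀ y, conjAct W c ((2 ^ 1 : ℕ) : ℤ) (ω y) =
      ω (ω (conjAct W c ((2 ^ 1 : ℕ) : ℤ) y)) := fun y ↦ by
    rw [← sub_eq_zero]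
    apply KolyvaginImageTwo.h1_restriction_injective_two W K hK.1 hsurj
    intro ρ hρ
    have hρ' : ρ ∈ torsionFixing (W.baseChange K) ((2 ^ 1 : ℕ) : ℤ) := hρ
    have hρ'' := ht.conjGalCMH_mem_torsionFixing W hinv ((2 ^ 1 : ℕ) : ℤ) hρ'
    show h1Eval (W.baseChange K) ((2 ^ 1 : ℕ) : ℤ)
      (conjAct W c ((2 ^ 1 : ℕ) : ℤ) (ω y) - ω (ω (conjAct W c ((2 ^ 1 : ℕ) : ℤ) y))) ρ = 0
    rw [sub_eq_add_neg, h1Eval_add _ _ _ _ hρ', h1Eval_neg _ _ _ hρ',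
      ht.h1Eval_conjAct W _ (ω y) hρ', hωeval y hρ'',
      hωeval (ω (conjAct W c ((2 ^ 1 : ℕ) : ℤ) y)) hρ', hωeval (conjAct W c ((2 ^ 1 : ℕ) : ℤ) y) hρ',
      ht.h1Eval_conjAct W _ y hρ', hkey, add_neg_cancel]
  -- ### local kernels are `ω`-stable
  have hω3 : ∀ (v : HeightOneSpectrum (𝓞 K)) (y : galH1Torsion (W.baseChange K) ((2 ^ 1 : ℕ) : ℤ)),
      y ∈ (W.baseChange K).torsionLocalKer (v.adicCompletion K) ((2 ^ 1 : ℕ) : ℤ) →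
        ω y ∈ (W.baseChange K).torsionLocalKer (v.adicCompletion K) ((2 ^ 1 : ℕ) : ℤ) := by
    intro v y hy
    haveI : CharZero (v.adicCompletion K) :=
      charZero_of_injective_algebraMap (algebraMap K (v.adicCompletion K)).injective
    exact coeffH1Map_mem_torsionLocalKer ψ hψ (v.adicCompletion K)
      (torsionPointsMap_bijective (W.baseChange K) (v.adicCompletion K) (n := 2 ^ 1) (by norm_num)).2 hy
  -- ### `x, ωx, x^c, ωx^c` are `𝔽₂`-independent (evaluate at `ρ₁`, `ρ₂`)
  obtain ⟨ρ₁, hρ₁, ρ₂, hρ₂, h11, h12, h21, h22⟩ := hgen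
  have hgen' : ∀ a b d e : ℤ, a • x + b • ω x + d • conjAct W c ((2 ^ 1 : ℕ) : ℤ) x +
      e • ω (conjAct W c ((2 ^ 1 : ℕ) : ℤ) x) = 0 →
      (2 : ℤ) ∣ a ∧ (2 : ℤ) ∣ b ∧ (2 : ℤ) ∣ d ∧ (2 : ℤ) ∣ e := by
    intro a b d e h
    have ev : ∀ {ρ : absoluteGaloisGroup K}, ρ ∈ torsionFixing (W.baseChange K) ((2 ^ 1 : ℕ) : ℤ) →
        a • h1Eval (W.baseChange K) ((2 ^ 1 : ℕ) : ℤ) x ρ +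
          b • (z • h1Eval (W.baseChange K) ((2 ^ 1 : ℕ) : ℤ) x ρ) +
          d • h1Eval (W.baseChange K) ((2 ^ 1 : ℕ) : ℤ) (conjAct W c ((2 ^ 1 : ℕ) : ℤ) x) ρ +
          e • (z • h1Eval (W.baseChange K) ((2 ^ 1 : ℕ) : ℤ) (conjAct W c ((2 ^ 1 : ℕ) : ℤ) x) ρ) =
            0 := by
      intro ρ hρ
      have h' := congrArg (fun s ↦ h1Eval (W.baseChange K) ((2 ^ 1 : ℕ) : ℤ) s ρ) h
      rwa [h1Eval_add _ _ _ _ hρ, h1Eval_add _ _ _ _ hρ, h1Eval_add _ _ _ _ hρ,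
        h1Eval_zsmul _ _ _ _ hρ, h1Eval_zsmul _ _ _ _ hρ, h1Eval_zsmul _ _ _ _ hρ,
        h1Eval_zsmul _ _ _ _ hρ, hωeval x hρ, hωeval _ hρ, h1Eval_zero _ _ hρ] at h'
    have e1 := ev hρ₁
    rw [h12, smul_zero, smul_zero, smul_zero, add_zero, add_zero] at e1
    have e2 := ev hρ₂
    rw [h21, smul_zero, smul_zero, smul_zero, zero_add, zero_add] at e2
    obtain ⟨ha, hb⟩ := two_dvd_of_zsmul_add_zsmul_smul_eq_zero (h2z _) (hzne _ h11) e1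
    obtain ⟨hd, he⟩ := two_dvd_of_zsmul_add_zsmul_smul_eq_zero (h2z _) (hzne _ h22) e2
    exact ⟨ha, hb, hd, he⟩
  exact ⟨ω, hω1, hω2, hω3, hgen'⟩

end Main

end Summit.BirchSwinnertonDyer.BirchSwinnertonDyer.Theorems.GenusExact

end
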